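import Summits.Ventures.YMGap.YM3IR.Statement
import Summits.Ventures.YMGap.YM3IR.CarrierFamily
import Summits.Ventures.YMGap.YM3IR.DecayTransferProof
import HarnessLib

/-!
# YM3IR / BalabanCofinal — the ONE composed statement, indexed by Bałaban's printed family (UV side's instantiation)

HONEST FRAMING (cell pub-ymgap, track Y4 / YM3-IR, seat ym3ir-theory-1, gen 3).  This file claims NO summit, NO mass gap
and NO part of Bałaban's theorems.  It is kernel-checked BOOKKEEPING that plugs the UV side's coupling set
(`CarrierBridge.balabanCouplings`, `CarrierFamily.lean`) into theory-2's composition `massGap3Cofinal_of`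
(`Statement.lean`): the hypothesis `¬ BddAbove I` of that composition is DISCHARGED for Bałaban's family (it is
`not_bddAbove_balabanCouplings`), the inhabitation of the family it needs is reduced to print's own clauses
(`family_nonempty_of`), the terminal-spacing function `ε₀(g)` is quantified in PRINT'S ORDER («∀ model ∃ ε₀ ∀ approximation»,
CMP 102 p. 256 L15–18) with the witness taken from Theorem 2 itself (`massGap3Cofinal_balaban_printedOrder`), and the
«at which β_eff» dictionary of the crossover is made a lemma (`betaTree_div_pow`, `betaTree_div_pow_le_iff`: after
Bałaban's `K` steps and `M'` further `L`-blockings canonical scaling puts the coarse law at tree coupling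
`1/(N γ₀² L^{M'})`, below a ceiling `β⋆` iff `L^{M'} ≥ 1/(N γ₀² β⋆)` — a number of extra steps INDEPENDENT of the
spacing `ε`, of `K` and of the volume; `betaTree_div_pow_le_of_le_gammaSq`: ONE `M'` serves every member whose terminal
coupling is bounded below, `γmin ≤ γ₀²` — the uniformity a fixed `C_b = N·L^{M'}` presupposes, which print's «ε₀ depending
on g only» supplies under the reading `ε₀(g) = γ₀²/g²` (`gammaSq_eq_of_eps0`, `betaTree_div_pow_le_of_eps0`: then
ONE `M'` for the whole family, PROVED) and the typed family does not enforce: LABELLED).  Every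
hypothesis of the end theorem is a NAMED `Prop` labelled IN PRINT (`BalabanUV3`), Y2 (`ClusterDomainClustering`),
CONJECTURE + SUPPORT (`T_IR`) exactly as in `Statement.lean`; no axioms, no `sorry`.

WHY THIS IS NOVEL (one sentence).  The infrared theorem fed by CMP 102 is now ONE kernel-checked implication whose index
set, quantifier order and crossover length are theorems rather than prose: `BalabanUV3 mk` yields print's `ε₀`, and AT THAT
`ε₀` the statement reads `ClusterDomainClustering ∧ T_IR(balabanCouplings) ⟹ MassGap3Cofinal (balabanCouplings)` with the
unboundedness of the coupling set proved, not assumed.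

WITH THE SUPPORT CONJUNCT DISCHARGED (§4; ds-1's `DecayTransferProof.decayTransfer`, in the tree).  For a continuous printed
representation `𝔊.ρ` the hypothesis `T_IR` contracts to theory-2's quotable conjecture `IRConjecture3` (∃ block family:
`EntersClusterDomain ∧ FluctuationDecoupling`), so on Bałaban's coupling set the statement reads
`BalabanUV3 mk ∧ ClusterDomainClustering ∧ IRConjecture3 (balabanCouplings) ⟹ MassGap3Cofinal (balabanCouplings)`
(`massGap3Cofinal_balaban_of_irConjecture3`, and `…_printedOrder_of_irConjecture3` at Theorem 2's own `ε₀`): every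
remaining hypothesis is IN PRINT by name, Y2's receiving theorem-to-be, or the ONE named conjecture — bookkeeping on
`DecayTransferProof.massGap3Cofinal_of_irConjecture3`, not a proof of anything about Yang–Mills.

NOT CLAIMED.  `MassGap3On (BalabanPair 𝔊 ε₀)` (CarrierBridge §4, provisional) is NOT derived from `MassGap3Cofinal` here:
the cofinal target's block length `b(β)` is existential, so the two restricted targets are related only through the
composition's block family (whose factor on Bałaban pairs is `L^{K+M'}`), i.e. through `FactorsThroughAveraging` — an
owed CONSTRUCTION, unchanged.  Nothing here touches the conjectures `EntersClusterDomain` / `FluctuationDecoupling`.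

References: T. Bałaban, CMP 102 (1985) 255–275, p. 256 L15–18, Thm 1 p. 257, Thm 2 p. 272 [cite: Balaban1985UV3];
K. Osterwalder, E. Seiler, Ann. Phys. 110 (1978) 440, Thm 3.5 [cite: OsterwalderSeilerAnnPhys1978].
-/

noncomputable section

open MeasureTheory
open Literature.MathematicalPhysics.QuantumFieldTheory Balaban1985CMP102 Balaban1985CMP102.Setting
  Balaban1985CMP102.Theorems
open Literature.MathematicalPhysics.QuantumFieldTheory.Balaban1983to89 (GaugeGroup HaarData)

namespace Summit.Ventures.YMGap.YM3IR.CarrierBridge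

variable {L : ℕ} {G : Type} [GaugeGroup G] [MeasurableSpace G]

/-! ## §1  Inhabitation of Bałaban's family from print's own clauses -/

/-- **The family is inhabited (PROVED from print's clauses).**  Block size `L > 1` ([4] = CMP 98 (1985), (1) p. 17 «L is a
fixed integer, L > 1»; oddness of `L` is NOT printed in the d = 3 series — it is the tree's standing convention, printed only
for d = 4 in CMP 109 (1987) p. 251 «L is an odd, positive integer > 11»), ONE coupling
`g > 0` at which the terminal spacing is positive (p. 256 L16–17 «ε₀ is a positive constant depending on the coupling
constant g only») and meets the cell's normalisation of «g_K sufficiently small», `g² ε₀(g) ≤ 1` (`Scales.gK_le_one`),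
give a member: the unit-lattice approximation `K = 0`, `ε = ε₀(g)`, `m = 0`.  This is the hypothesis
`Nonempty (Family L eps0)` of `not_bddAbove_balabanCouplings`. [cite: Balaban1985UV3, p.256 L15–18] -/
theorem family_nonempty_of (hL : Odd L ∧ 1 < L) {eps0 : ℝ → ℝ} {g : ℝ} (hg : 0 < g) (he : 0 < eps0 g)
    (hge : g ^ 2 * eps0 g ≤ 1) : Nonempty (Family L eps0) :=
  ⟨⟨{ hL := hL, m := 0, K := 0, ε := eps0 g, ε_pos := he, ε₀ := eps0 g, hK := by simp, g := g, g_pos := hg,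
      gK_le_one := hge }, rfl⟩⟩

/-- Hence the coupling set is unbounded above under the same printed clauses (bookkeeping: `family_nonempty_of` +
`not_bddAbove_balabanCouplings`). [cite: Balaban1985UV3, p.256 L15–18] -/
theorem not_bddAbove_balabanCouplings_of (𝔊 : GroupModel G) (hL : Odd L ∧ 1 < L) {eps0 : ℝ → ℝ} {g : ℝ}
    (hg : 0 < g) (he : 0 < eps0 g) (hge : g ^ 2 * eps0 g ≤ 1) : ¬ BddAbove (balabanCouplings L 𝔊 eps0) :=
  not_bddAbove_balabanCouplings 𝔊 (family_nonempty_of hL hg he hge)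

/-! ## §2  «At which β_eff»: the coupling of the coarse law after `K + M'` steps, in canonical scaling -/

/-- **Canonical-scaling coupling after Bałaban's `K` steps and `M'` further `L`-blockings (PROVED arithmetic):**
`β_S / L^{K+M'} = 1/(N · γ₀² · L^{M'})` with `γ₀² = g²ε₀` (`Dictionary.gammaSq`) — independent of `ε`, `K`, `m`.  In Wilson
units this is `β_W,eff = 1/(γ₀² L^{M'})` (`Dictionary.betaWTerminal / L^{M'}`); canonical scaling `β_eff(b) = β/b` is the
`d = 3` dimension count behind the clause `b(β) ≤ C_b β` of `EntersClusterDomain`, NOT a theorem about the effective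
action (that is the conjecture). [cite: Balaban1985UV3, (1), (5) p.256] -/
theorem betaTree_div_pow (𝔊 : GroupModel G) (S : Scales L) (M' : ℕ) :
    betaTree 𝔊 S / (L : ℝ) ^ (S.K + M') = ((𝔊.N : ℝ) * Dictionary.gammaSq S * (L : ℝ) ^ M')⁻¹ := by
  have hL : (0 : ℝ) < (L : ℝ) := by exact_mod_cast lt_trans zero_lt_one S.hL.2
  have hLK : (L : ℝ) ^ S.K ≠ 0 := (pow_pos hL _).ne'
  have hLM : (L : ℝ) ^ M' ≠ 0 := (pow_pos hL _).ne'
  have hN : (𝔊.N : ℝ) ≠ 0 := by exact_mod_cast 𝔊.N_pos.ne'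
  have hg : S.g ^ 2 ≠ 0 := (pow_pos S.g_pos 2).ne'
  have hε : S.ε ≠ 0 := S.ε_pos.ne'
  have hε₀ : S.ε₀ = (L : ℝ) ^ S.K * S.ε := S.hK.symm
  unfold betaTree Scales.g0sq Dictionary.gammaSq
  rw [hε₀, pow_add]
  field_simp

/-- **How many extra steps (PROVED arithmetic):** the canonical-scaling coupling after `K + M'` steps is below a ceiling
`βstar > 0` (tree units, `β = β_W/N`) iff `L^{M'} ≥ 1/(N γ₀² βstar)` — so the number `M'` of `O(1)`-coupling steps the
crossover `EntersClusterDomain` has to control is `⌈log_L (1/(N γ₀² β⋆))⌉`, a function of `(N, γ₀, β⋆, L)` only: finite and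
uniform in the spacing and the volume (the `d = 3` super-renormalisable count; in `d = 4` the analogous count is the
`≳ 10⁷⁰`-step `CrossoverLedger.HandOver`).  With `γ₀² ≤ 1` (`Dictionary.gammaSq_le_one`) and the certified `d = 3` balls at
`N β⋆ < 1`, `M' ≥ 1` always: the window mismatch `Dictionary.one_le_betaWTerminal` in counted form.
[cite: Balaban1985UV3, (5) p.256] -/
theorem betaTree_div_pow_le_iff (𝔊 : GroupModel G) (S : Scales L) (M' : ℕ) {βstar : ℝ} (hβ : 0 < βstar) :
    betaTree 𝔊 S / (L : ℝ) ^ (S.K + M') ≤ βstar ↔ ((𝔊.N : ℝ) * Dictionary.gammaSq S * βstar)⁻¹ ≤ (L : ℝ) ^ M' := by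
  have hL : (0 : ℝ) < (L : ℝ) := by exact_mod_cast lt_trans zero_lt_one S.hL.2
  have hLM : (0 : ℝ) < (L : ℝ) ^ M' := pow_pos hL _
  have hN : (0 : ℝ) < 𝔊.N := by exact_mod_cast 𝔊.N_pos
  have hc : 0 < (𝔊.N : ℝ) * Dictionary.gammaSq S := mul_pos hN (Dictionary.gammaSq_pos S)
  rw [betaTree_div_pow, inv_le_iff_one_le_mul₀' (mul_pos hc hLM), inv_le_iff_one_le_mul₀' (mul_pos hc hβ),
    mul_right_comm]

/-- **Uniform counted crossover (PROVED arithmetic; its hypothesis is LABELLED, not in the typed family).**  If the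
terminal coupling is bounded BELOW on the family, `γmin ≤ γ₀²(S)` for the member `S` — print's «ε₀ … depending on the
coupling constant g only» under the natural reading `ε₀(g) = γ₀²/g²` (ONE terminal coupling for all bare couplings) gives
`γmin = γ₀²`; the typed `Family L eps0` does NOT enforce it (it allows `g² ε₀(g) → 0` along `g → 0`) — then ONE `M'` with
`L^{M'} ≥ 1/(N γmin β⋆)` puts the canonical-scaling coupling of EVERY such member after `K + M'` steps below `β⋆`.  This is
the uniformity in the coupling set that `EntersClusterDomain … C_b` with the FIXED `C_b = N·L^{M'}` of
`pow_le_mul_betaTree` presupposes at tree level; without a lower bound on `γ₀²` no fixed `M'` serves all members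
(honest residue, recorded in the seat's md §13). [cite: Balaban1985UV3, p.256 L15–18; (5) p.256] -/
theorem betaTree_div_pow_le_of_le_gammaSq (𝔊 : GroupModel G) (S : Scales L) (M' : ℕ) {βstar γmin : ℝ}
    (hβ : 0 < βstar) (hγ : 0 < γmin) (hγS : γmin ≤ Dictionary.gammaSq S)
    (hM : ((𝔊.N : ℝ) * γmin * βstar)⁻¹ ≤ (L : ℝ) ^ M') :
    betaTree 𝔊 S / (L : ℝ) ^ (S.K + M') ≤ βstar := by
  have hN : (0 : ℝ) < 𝔊.N := by exact_mod_cast 𝔊.N_pos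
  rw [betaTree_div_pow_le_iff 𝔊 S M' hβ]
  refine le_trans (inv_anti₀ (mul_pos (mul_pos hN hγ) hβ) ?_) hM
  exact mul_le_mul_of_nonneg_right (mul_le_mul_of_nonneg_left hγS hN.le) hβ.le

/-- **Print's «ε₀ depending on g only» read as ONE terminal coupling (PROVED bookkeeping).**  If `ε₀(g) = γ/g²` on
`g > 0` then every member of `Family L eps0` has terminal coupling `γ₀²(S) = g²ε₀(g) = γ` — the reading under which
the coupling set `balabanCouplings L 𝔊 eps0` is the geometric sequence `{L^K/(N γ)}` and the uniformity hypothesis of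
`betaTree_div_pow_le_of_le_gammaSq` holds with `γmin = γ`. [cite: Balaban1985UV3, p.256 L15–18] -/
theorem gammaSq_eq_of_eps0 {eps0 : ℝ → ℝ} {γ : ℝ} (h : ∀ g : ℝ, 0 < g → eps0 g = γ / g ^ 2) (S : Family L eps0) :
    Dictionary.gammaSq S.1 = γ := by
  have hg : S.1.g ≠ 0 := S.1.g_pos.ne'
  unfold Dictionary.gammaSq
  rw [S.2, h _ S.1.g_pos]
  field_simp

/-- **Hence ONE crossover length for the whole family (PROVED arithmetic, under that reading):** with `ε₀(g) = γ/g²`,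
any `M'` with `L^{M'} ≥ 1/(N γ β⋆)` puts EVERY member's canonical-scaling coupling after `K + M'` steps below `β⋆` —
`M' = ⌈log_L(1/(N γ β⋆))⌉` serves the entire coupling set, as the fixed `C_b = N·L^{M'}` of `EntersClusterDomain` wants.
[cite: Balaban1985UV3, p.256 L15–18; (5) p.256] -/
theorem betaTree_div_pow_le_of_eps0 (𝔊 : GroupModel G) {eps0 : ℝ → ℝ} {γ βstar : ℝ} (hγ : 0 < γ)
    (hβ : 0 < βstar) (h : ∀ g : ℝ, 0 < g → eps0 g = γ / g ^ 2) (M' : ℕ)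
    (hM : ((𝔊.N : ℝ) * γ * βstar)⁻¹ ≤ (L : ℝ) ^ M') (S : Family L eps0) :
    betaTree 𝔊 S.1 / (L : ℝ) ^ (S.1.K + M') ≤ βstar :=
  betaTree_div_pow_le_of_le_gammaSq 𝔊 S.1 M' hβ hγ (gammaSq_eq_of_eps0 h S).ge hM

end Summit.Ventures.YMGap.YM3IR.CarrierBridge

namespace Summit.Ventures.YMGap.YM3IR

open CarrierBridge

variable {L : ℕ} {G : Type} [GaugeGroup G] [MeasurableSpace G] [TopologicalSpace G] [IsTopologicalGroup G]
  [CompactSpace G] [BorelSpace G]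

/-! ## §3  The composed statement on Bałaban's coupling set -/

/-- **`massGap3Cofinal_balaban_of` — theory-2's composition AT the UV side's coupling set (PROVED bookkeeping).**  For a
group as printed `𝔊` (fine laws in the representation `𝔊.ρ`, tree coupling `β = 1/(N g²ε)` — `CarrierBridge.betaTree`,
`wilsonAction_configEquiv`), ANY terminal-spacing function `eps0` whose family is inhabited, Y2's ball `B`, a link weight
`r` bounded above and positive constants: `BalabanUV3 mk ∧ ClusterDomainClustering B r m_c ∧ T_IR mk B r 𝔊.ρ
(balabanCouplings L 𝔊 eps0) C_b κ m_c ⟹ MassGap3Cofinal (balabanCouplings L 𝔊 eps0) r 𝔊.ρ` — the hypothesis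
`¬ BddAbove I` of `massGap3Cofinal_of` is discharged by `not_bddAbove_balabanCouplings`.  Which `eps0` makes `T_IR`
the RIGHT conjecture is print's (next theorem); logically any inhabited `eps0` will do here because `T_IR` is a
hypothesis. [cite: Balaban1985UV3, Thm 1 p.257; Thm 2 p.272] -/
theorem massGap3Cofinal_balaban_of {mk : Construction L} (𝔊 : GroupModel G) {eps0 : ℝ → ℝ}
    (hfam : Nonempty (Family L eps0)) {B : BallSpec G 𝔊.N} {r : G → G → ℝ} {C_b κ m_c : ℝ}
    (hC : 0 < C_b) (hκ : 0 < κ) (hm : 0 < m_c) (hr : ∃ D : ℝ, ∀ a b : G, r a b ≤ D) (hUV : BalabanUV3 mk)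
    (hRB : ClusterDomainClustering B r m_c) (hIR : T_IR mk B r 𝔊.ρ (balabanCouplings L 𝔊 eps0) C_b κ m_c) :
    MassGap3Cofinal (balabanCouplings L 𝔊 eps0) r 𝔊.ρ :=
  massGap3Cofinal_of (not_bddAbove_balabanCouplings 𝔊 hfam) hC hκ hm hr hUV hRB hIR

/-- **`massGap3Cofinal_balaban_printedOrder` — the same, with `ε₀(g)` in PRINT'S quantifier order (PROVED bookkeeping).**
From `BalabanUV3 mk`: for every group as printed there is Bałaban's terminal-spacing function `eps0`, positive on `g > 0`
(p. 256 L15–18: «ε₀ is a positive constant depending on the coupling constant g only» — `∃ eps0` AFTER the model, BEFORE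
the family), AT WHICH (i) every approximation of the family satisfies Theorem 2's inequalities (41)/(47) at every step
`k ≤ K` — this conjunct pins WHICH `eps0` the infrared conjecture `T_IR` is about: the one whose terminal densities have
the printed small-field/large-field form — and (ii) for every ball, bounded link weight and positive constants, once the
family is inhabited, `ClusterDomainClustering ∧ T_IR(balabanCouplings L 𝔊 eps0) ⟹ MassGap3Cofinal (balabanCouplings L 𝔊
eps0)`.  The IR side cannot choose `ε₀`; it receives it (= `uvDelivers_of_balaban`'s order, now at the level of the
target of record).  Witness: Theorem 2's own `eps0` (`thm2AsPrintedC_iff`). [cite: Balaban1985UV3, p.256 L15–18; Thm 2 p.272] -/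
theorem massGap3Cofinal_balaban_printedOrder [HaarData G] (mk : Construction L) (hUV : BalabanUV3 mk)
    (𝔊 : GroupModel G) :
    ∃ eps0 : ℝ → ℝ, (∀ g : ℝ, 0 < g → 0 < eps0 g) ∧
      (∀ S : Family L eps0, ∀ k, k ≤ S.1.K → (mk G 𝔊 S.1).ineq41_47 k) ∧
      ∀ (B : BallSpec G 𝔊.N) (r : G → G → ℝ) (C_b κ m_c : ℝ), 0 < C_b → 0 < κ → 0 < m_c →
        (∃ D : ℝ, ∀ a b : G, r a b ≤ D) → Nonempty (Family L eps0) → ClusterDomainClustering B r m_c →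
          T_IR mk B r 𝔊.ρ (balabanCouplings L 𝔊 eps0) C_b κ m_c →
            MassGap3Cofinal (balabanCouplings L 𝔊 eps0) r 𝔊.ρ := by
  obtain ⟨eps0, hpos, h2⟩ := (thm2AsPrintedC_iff mk).1 hUV.2 G 𝔊
  exact ⟨eps0, hpos, h2, fun B r C_b κ m_c hC hκ hm hr hfam hRB hIR =>
    massGap3Cofinal_balaban_of 𝔊 hfam hC hκ hm hr hUV hRB hIR⟩

/-- **At print's `eps0` the inhabitation clause is just the cell's normalisation at ONE coupling (PROVED bookkeeping):**
`eps0` positive on positives (print) and some `g > 0` with `g² eps0(g) ≤ 1` (the cell's reading of «g_K sufficiently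
small», `Scales.gK_le_one`) inhabit the family, given the block size `L > 1` of [4] (CMP 98 (1) p. 17; `L` odd = tree
convention). [cite: Balaban1985UV3, p.256 L15–18] -/
theorem family_nonempty_of_pos (hL : Odd L ∧ 1 < L) {eps0 : ℝ → ℝ} (hpos : ∀ g : ℝ, 0 < g → 0 < eps0 g)
    (hsmall : ∃ g : ℝ, 0 < g ∧ g ^ 2 * eps0 g ≤ 1) : Nonempty (Family L eps0) := by
  obtain ⟨g, hg, hge⟩ := hsmall
  exact family_nonempty_of hL hg (hpos g hg) hge

/-! ## §4  With `DecayTransfer` PROVED (ds-1): the quotable form on Bałaban's coupling set -/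

/-- **`massGap3Cofinal_balaban_of_irConjecture3` (PROVED bookkeeping).**  For a continuous printed representation `𝔊.ρ`
and an inhabited family: `BalabanUV3 mk → ClusterDomainClustering B r m_c → IRConjecture3 B r 𝔊.ρ (balabanCouplings L 𝔊 eps0)
C_b κ → MassGap3Cofinal (balabanCouplings L 𝔊 eps0) r 𝔊.ρ` — theory-2's composition with `T_IR`'s support conjunct
`DecayTransfer` discharged by ds-1's `DecayTransferProof.decayTransfer` and `¬ BddAbove I` discharged by
`not_bddAbove_balabanCouplings`.  The ONE non-printed, non-Y2 hypothesis left is `IRConjecture3` (CONJECTURE: a block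
family entering Y2's ball with massive fluctuation fields), asked on the UV side's coupling set.
[cite: Balaban1985UV3, Thm 1 p.257; Thm 2 p.272] -/
theorem massGap3Cofinal_balaban_of_irConjecture3 {mk : Construction L} (𝔊 : GroupModel G) (hρ : Continuous 𝔊.ρ)
    {eps0 : ℝ → ℝ} (hfam : Nonempty (Family L eps0)) {B : BallSpec G 𝔊.N} {r : G → G → ℝ} {C_b κ m_c : ℝ}
    (hC : 0 < C_b) (hκ : 0 < κ) (hm : 0 < m_c) (hr : ∃ D : ℝ, ∀ a b : G, r a b ≤ D) (hUV : BalabanUV3 mk)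
    (hRB : ClusterDomainClustering B r m_c) (hIR : IRConjecture3 B r 𝔊.ρ (balabanCouplings L 𝔊 eps0) C_b κ) :
    MassGap3Cofinal (balabanCouplings L 𝔊 eps0) r 𝔊.ρ :=
  DecayTransferProof.massGap3Cofinal_of_irConjecture3 hρ (not_bddAbove_balabanCouplings 𝔊 hfam) hC hκ hm hr hUV
    hRB hIR

/-- **The same in PRINT'S quantifier order (PROVED bookkeeping):** from `BalabanUV3 mk`, at THEOREM 2's own terminal
spacing `ε₀` (positive on `g > 0`, inequalities (41)/(45)–(47) along the family), for every ball, bounded link weight and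
positive constants: `Nonempty (Family L eps0) → ClusterDomainClustering B r m_c → IRConjecture3 B r 𝔊.ρ (balabanCouplings L
𝔊 eps0) C_b κ → MassGap3Cofinal (balabanCouplings L 𝔊 eps0) r 𝔊.ρ`.  This is the honest promise of the YM₃ infrared
page on the UV side's own index set: print ∧ Y2 ∧ ONE conjecture ⟹ the cofinal lattice mass gap, kernel-checked.
[cite: Balaban1985UV3, p.256 L15–18; Thm 2 p.272] -/
theorem massGap3Cofinal_balaban_printedOrder_of_irConjecture3 [HaarData G] (mk : Construction L)
    (hUV : BalabanUV3 mk) (𝔊 : GroupModel G) (hρ : Continuous 𝔊.ρ) :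
    ∃ eps0 : ℝ → ℝ, (∀ g : ℝ, 0 < g → 0 < eps0 g) ∧
      (∀ S : Family L eps0, ∀ k, k ≤ S.1.K → (mk G 𝔊 S.1).ineq41_47 k) ∧
      ∀ (B : BallSpec G 𝔊.N) (r : G → G → ℝ) (C_b κ m_c : ℝ), 0 < C_b → 0 < κ → 0 < m_c →
        (∃ D : ℝ, ∀ a b : G, r a b ≤ D) → Nonempty (Family L eps0) → ClusterDomainClustering B r m_c →
          IRConjecture3 B r 𝔊.ρ (balabanCouplings L 𝔊 eps0) C_b κ →
            MassGap3Cofinal (balabanCouplings L 𝔊 eps0) r 𝔊.ρ := by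
  obtain ⟨eps0, hpos, h2⟩ := (thm2AsPrintedC_iff mk).1 hUV.2 G 𝔊
  exact ⟨eps0, hpos, h2, fun B r C_b κ m_c hC hκ hm hr hfam hRB hIR =>
    massGap3Cofinal_balaban_of_irConjecture3 𝔊 hρ hfam hC hκ hm hr hUV hRB hIR⟩

end Summit.Ventures.YMGap.YM3IR

end
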